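import Summits.MatrixMultiplication.OmegaCensus.CubeLawNoCosetPartThreeSix

/-!
# No part of size three over `ℤ_m × ℤ_l` when `m ≥ 4` and `2m ∣ l` (kernel; a parity obstruction on top of the constant-six bound)

ω-census `pub-omega`, family (b3), seat pub-omega-group gen 35.  Framing: lottery ticket; floor = certified bounds/negative
ranges.  VALUE: a new infinite family of KERNEL `|W| = 3` cells; NOT progress on ω; no census word changes.  Newly KERNEL (were
ENGINE / computational NONE in the census ≤ 1000): `ℤ_4 × ℤ_16` (64), `ℤ_5 × ℤ_20` (100), `ℤ_4 × ℤ_88` (352), `ℤ_5 × ℤ_110` (550),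
`ℤ_4 × ℤ_160` (640), `ℤ_4 × ℤ_232` (928), `ℤ_5 × ℤ_200` (1000) — i.e. the `k` EVEN half of the two families `ℤ_4 × ℤ_{4k}`,
`ℤ_5 × ℤ_{5k}` left open by `ThreeSetTilingPartThreeSix` (indices `4` and `5`).

The argument.  By `card_le_of_cube_form_part_three_six` each of the three difference vectors `d` of a part `W = {w, w', w''}`
satisfies `ml = |A| ≤ 6·ord(d) + 4`, so `ord(d) > l/2` as soon as `m ≥ 4` (and `l > 4`).  If `2m ∣ l`, an element `d = (x, y)` of
`ℤ_m × ℤ_l` whose second coordinate `y` is even satisfies `(l/2)·d = 0` (`(l/2)·x = 0` because `m ∣ l/2`), hence has order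
`≤ l/2`; so all three second coordinates `y', y'', y' − y''` would be odd — impossible.

* `addOrderOf_le_half_of_even` — `2m ∣ l`, `2 ∣ y.val` ⇒ `ord (x, y) ≤ l/2`.
* `even_val_or` — for `l` even, among `y₁, y₂, y₁ − y₂ ∈ ℤ_l` one has an even representative.
* `no_three_large_orders` — `m ≥ 4`, `2m ∣ l`: three elements `d₁, d₂, d₁ − d₂` cannot all satisfy `ml ≤ 6·ord + 4`.
* **`cube_form_no_part_three_zmod_prod_even`** — `m ≥ 4`, `2m ∣ l`: a cube symmetric form over `ℤ_m × ℤ_l` has no part of size `3`.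
* **`cube_law_no_coset_part_three_zmod_prod_even`** — the same for the coset parts of a TPP triple of a dihedral-like group over
  `ℤ_m × ℤ_l` (any parity, any `c₀`) attaining `3|S||T||U| + 8 = 8|A|`.

What remains open in the `|W| = 3` column after this file and `ThreeSetTilingPartThreeSix`: `ℤ_4 × ℤ_{4k}` and `ℤ_5 × ℤ_{5k}` with
`k` ODD (census-relevant: `k ≡ 13 (mod 18)`, e.g. `ℤ_4 × ℤ_52`, `ℤ_5 × ℤ_65`), see HOME/pub-omega-group-g35/RESULTS-g35.md.
-/

namespace Summit.MatrixMultiplication.OmegaCensus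

open Finset

section Parity

variable {m l : ℕ} [NeZero l]

/-- If `2m ∣ l` and the second coordinate of `d ∈ ℤ_m × ℤ_l` has an even representative, then `(l/2) • d = 0`, so
`ord d ≤ l/2`. [folklore] -/
theorem addOrderOf_le_half_of_even (h2m : 2 * m ∣ l) (d : ZMod m × ZMod l) (hd : 2 ∣ d.2.val) :
    addOrderOf d ≤ l / 2 := by
  obtain ⟨q, hq⟩ := h2m
  obtain ⟨t, ht⟩ := hd
  have hl2 : l / 2 = m * q := by rw [hq, mul_assoc, Nat.mul_div_cancel_left _ two_pos]
  have hl0 : l ≠ 0 := NeZero.ne l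
  have hpos : 0 < l / 2 := by
    rw [hl2]
    rw [hq] at hl0
    exact Nat.pos_of_ne_zero fun h0 => hl0 (by rw [mul_assoc, h0, mul_zero])
  refine Nat.le_of_dvd hpos (addOrderOf_dvd_iff_nsmul_eq_zero.2 ?_)
  have h1 : (l / 2) • d.1 = 0 := by
    rw [nsmul_eq_mul, hl2, Nat.cast_mul, ZMod.natCast_self, zero_mul, zero_mul]
  have h2 : (l / 2) • d.2 = 0 := by
    rw [nsmul_eq_mul, ← ZMod.natCast_zmod_val d.2, ht, ← Nat.cast_mul, ZMod.natCast_eq_zero_iff, hl2, hq]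
    exact ⟨t, by ring⟩
  exact Prod.ext h1 h2

/-- For `l` even, among `y₁`, `y₂`, `y₁ − y₂ ∈ ℤ_l` at least one has an even representative. [folklore] -/
theorem even_val_or (hl : 2 ∣ l) (y₁ y₂ : ZMod l) : 2 ∣ y₁.val ∨ 2 ∣ y₂.val ∨ 2 ∣ (y₁ - y₂).val := by
  have h := ZMod.val_add (y₁ - y₂) y₂
  rw [sub_add_cancel] at h
  have hp : y₁.val % 2 = ((y₁ - y₂).val + y₂.val) % 2 := by rw [h, Nat.mod_mod_of_dvd _ hl]
  omega

/-- `m ≥ 4`, `2m ∣ l`: three elements `d₁, d₂, d₁ − d₂` of `ℤ_m × ℤ_l` cannot all satisfy `ml ≤ 6·ord + 4`. [folklore] -/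
theorem no_three_large_orders (h2m : 2 * m ∣ l) (hm : 4 ≤ m) (d₁ d₂ : ZMod m × ZMod l)
    (h₁ : m * l ≤ 6 * addOrderOf d₁ + 4) (h₂ : m * l ≤ 6 * addOrderOf d₂ + 4)
    (h₃ : m * l ≤ 6 * addOrderOf (d₁ - d₂) + 4) : False := by
  have hl0 : l ≠ 0 := NeZero.ne l
  have hl8 : 8 ≤ l := by
    obtain ⟨q, hq⟩ := h2m
    rcases Nat.eq_zero_or_pos q with rfl | hq0
    · simp at hq; exact absurd hq hl0
    · nlinarith
  have hml : 4 * l ≤ m * l := Nat.mul_le_mul_right l hm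
  have hl : 2 ∣ l := (dvd_mul_right 2 m).trans h2m
  rcases even_val_or hl d₁.2 d₂.2 with e | e | e
  · have := addOrderOf_le_half_of_even h2m d₁ e; omega
  · have := addOrderOf_le_half_of_even h2m d₂ e; omega
  · rw [← Prod.snd_sub] at e
    have := addOrderOf_le_half_of_even h2m (d₁ - d₂) e; omega

variable [NeZero m]

/-- `|W| ≠ 3` for the first part of a cube symmetric form over `ℤ_m × ℤ_l`, `m ≥ 4`, `2m ∣ l`. [folklore] -/
theorem cube_form_card_ne_three_zmod_prod_even (h2m : 2 * m ∣ l) (hm : 4 ≤ m) {W X Y : Finset (ZMod m × ZMod l)}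
    {x₀ : ZMod m × ZMod l}
    (h₁ : Set.InjOn (fun q : (ZMod m × ZMod l) × (ZMod m × ZMod l) × (ZMod m × ZMod l) => -q.1 + q.2.1 + q.2.2)
      ↑(W ×ˢ X ×ˢ Y))
    (h₂ : Set.InjOn (fun q : (ZMod m × ZMod l) × (ZMod m × ZMod l) × (ZMod m × ZMod l) => q.1 - q.2.1 + q.2.2)
      ↑(W ×ˢ X ×ˢ Y))
    (h₃ : Set.InjOn (fun q : (ZMod m × ZMod l) × (ZMod m × ZMod l) × (ZMod m × ZMod l) => q.1 + q.2.1 - q.2.2)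
      ↑(W ×ˢ X ×ˢ Y))
    (d₁₂ : Disjoint ((W ×ˢ X ×ˢ Y).image fun q => -q.1 + q.2.1 + q.2.2) ((W ×ˢ X ×ˢ Y).image fun q => q.1 - q.2.1 + q.2.2))
    (d₁₃ : Disjoint ((W ×ˢ X ×ˢ Y).image fun q => -q.1 + q.2.1 + q.2.2) ((W ×ˢ X ×ˢ Y).image fun q => q.1 + q.2.1 - q.2.2))
    (d₂₃ : Disjoint ((W ×ˢ X ×ˢ Y).image fun q => q.1 - q.2.1 + q.2.2) ((W ×ˢ X ×ˢ Y).image fun q => q.1 + q.2.1 - q.2.2))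
    (hcover : ((W ×ˢ X ×ˢ Y).image fun q => -q.1 + q.2.1 + q.2.2) ∪ ((W ×ˢ X ×ˢ Y).image fun q => q.1 - q.2.1 + q.2.2) ∪
      ((W ×ˢ X ×ˢ Y).image fun q => q.1 + q.2.1 - q.2.2) = univ.erase x₀) :
    W.card ≠ 3 := by
  intro hW
  have hcard : Fintype.card (ZMod m × ZMod l) = m * l := by rw [Fintype.card_prod, ZMod.card, ZMod.card]
  obtain ⟨w, w', w'', hww', hww'', hw'w'', hWeq⟩ := card_eq_three.1 hW
  have hw : w ∈ W := by rw [hWeq]; simp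
  have hw' : w' ∈ W := by rw [hWeq]; simp
  have hw'' : w'' ∈ W := by rw [hWeq]; simp
  have b₁ := card_le_of_cube_form_part_three_six h₁ h₂ h₃ d₁₂ d₁₃ d₂₃ hcover hW hw hw' hww'
  have b₂ := card_le_of_cube_form_part_three_six h₁ h₂ h₃ d₁₂ d₁₃ d₂₃ hcover hW hw hw'' hww''
  have b₃ := card_le_of_cube_form_part_three_six h₁ h₂ h₃ d₁₂ d₁₃ d₂₃ hcover hW hw'' hw' hw'w''.symm
  rw [hcard] at b₁ b₂ b₃
  rw [show w' - w'' = (w' - w) - (w'' - w) by abel] at b₃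
  exact no_three_large_orders h2m hm (w' - w) (w'' - w) b₁ b₂ b₃

/-- **No part of size three over `ℤ_m × ℤ_l`, `m ≥ 4`, `2m ∣ l`** (kernel; e.g. `ℤ_4 × ℤ_16`, `ℤ_5 × ℤ_20`, `ℤ_4 × ℤ_88`,
`ℤ_5 × ℤ_110`, `ℤ_4 × ℤ_160`, `ℤ_4 × ℤ_232`, `ℤ_5 × ℤ_200`, and every `ℤ_4 × ℤ_{4k}`, `ℤ_5 × ℤ_{5k}` with `k` even). [folklore] -/
theorem cube_form_no_part_three_zmod_prod_even (h2m : 2 * m ∣ l) (hm : 4 ≤ m) {W X Y : Finset (ZMod m × ZMod l)}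
    {x₀ : ZMod m × ZMod l}
    (h₁ : Set.InjOn (fun q : (ZMod m × ZMod l) × (ZMod m × ZMod l) × (ZMod m × ZMod l) => -q.1 + q.2.1 + q.2.2)
      ↑(W ×ˢ X ×ˢ Y))
    (h₂ : Set.InjOn (fun q : (ZMod m × ZMod l) × (ZMod m × ZMod l) × (ZMod m × ZMod l) => q.1 - q.2.1 + q.2.2)
      ↑(W ×ˢ X ×ˢ Y))
    (h₃ : Set.InjOn (fun q : (ZMod m × ZMod l) × (ZMod m × ZMod l) × (ZMod m × ZMod l) => q.1 + q.2.1 - q.2.2)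
      ↑(W ×ˢ X ×ˢ Y))
    (d₁₂ : Disjoint ((W ×ˢ X ×ˢ Y).image fun q => -q.1 + q.2.1 + q.2.2) ((W ×ˢ X ×ˢ Y).image fun q => q.1 - q.2.1 + q.2.2))
    (d₁₃ : Disjoint ((W ×ˢ X ×ˢ Y).image fun q => -q.1 + q.2.1 + q.2.2) ((W ×ˢ X ×ˢ Y).image fun q => q.1 + q.2.1 - q.2.2))
    (d₂₃ : Disjoint ((W ×ˢ X ×ˢ Y).image fun q => q.1 - q.2.1 + q.2.2) ((W ×ˢ X ×ˢ Y).image fun q => q.1 + q.2.1 - q.2.2))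
    (hcover : ((W ×ˢ X ×ˢ Y).image fun q => -q.1 + q.2.1 + q.2.2) ∪ ((W ×ˢ X ×ˢ Y).image fun q => q.1 - q.2.1 + q.2.2) ∪
      ((W ×ˢ X ×ˢ Y).image fun q => q.1 + q.2.1 - q.2.2) = univ.erase x₀) :
    W.card ≠ 3 ∧ X.card ≠ 3 ∧ Y.card ≠ 3 := by
  obtain ⟨i₁, i₂, i₃, e₁₂, e₁₃, e₂₃, ecov⟩ := cube_symmetric_form_rotate h₁ h₂ h₃ d₁₂ d₁₃ d₂₃ hcover
  obtain ⟨j₁, j₂, j₃, f₁₂, f₁₃, f₂₃, fcov⟩ := cube_symmetric_form_rotate i₁ i₂ i₃ e₁₂ e₁₃ e₂₃ ecov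
  exact ⟨cube_form_card_ne_three_zmod_prod_even h2m hm h₁ h₂ h₃ d₁₂ d₁₃ d₂₃ hcover,
    cube_form_card_ne_three_zmod_prod_even h2m hm i₁ i₂ i₃ e₁₂ e₁₃ e₂₃ ecov,
    cube_form_card_ne_three_zmod_prod_even h2m hm j₁ j₂ j₃ f₁₂ f₁₃ f₂₃ fcov⟩

/-- `|W| ≠ 3` in a three-set SHIFTED form over `ℤ_m × ℤ_l`, `m ≥ 4`, `2m ∣ l`. [folklore] -/
theorem shifted_form_card_ne_three_zmod_prod_even (h2m : 2 * m ∣ l) (hm : 4 ≤ m) {W X Y : Finset (ZMod m × ZMod l)}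
    {κ₁ κ₂ κ₃ x₀ : ZMod m × ZMod l}
    (i₁ : Set.InjOn (fun p : (ZMod m × ZMod l) × (ZMod m × ZMod l) × (ZMod m × ZMod l) => p.1 + p.2.1 + p.2.2)
      ↑((W.image fun w => κ₁ - w) ×ˢ X ×ˢ Y))
    (i₂ : Set.InjOn (fun p : (ZMod m × ZMod l) × (ZMod m × ZMod l) × (ZMod m × ZMod l) => p.1 + p.2.1 + p.2.2)
      ↑(W ×ˢ (X.image fun x => κ₂ - x) ×ˢ Y))
    (i₃ : Set.InjOn (fun p : (ZMod m × ZMod l) × (ZMod m × ZMod l) × (ZMod m × ZMod l) => p.1 + p.2.1 + p.2.2)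
      ↑(W ×ˢ X ×ˢ (Y.image fun y => κ₃ - y)))
    (d₁₂ : Disjoint (((W.image fun w => κ₁ - w) ×ˢ X ×ˢ Y).image fun p => p.1 + p.2.1 + p.2.2)
      ((W ×ˢ (X.image fun x => κ₂ - x) ×ˢ Y).image fun p => p.1 + p.2.1 + p.2.2))
    (d₁₃ : Disjoint (((W.image fun w => κ₁ - w) ×ˢ X ×ˢ Y).image fun p => p.1 + p.2.1 + p.2.2)
      ((W ×ˢ X ×ˢ (Y.image fun y => κ₃ - y)).image fun p => p.1 + p.2.1 + p.2.2))
    (d₂₃ : Disjoint ((W ×ˢ (X.image fun x => κ₂ - x) ×ˢ Y).image fun p => p.1 + p.2.1 + p.2.2)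
      ((W ×ˢ X ×ˢ (Y.image fun y => κ₃ - y)).image fun p => p.1 + p.2.1 + p.2.2))
    (hcover : (((W.image fun w => κ₁ - w) ×ˢ X ×ˢ Y).image fun p => p.1 + p.2.1 + p.2.2) ∪
      ((W ×ˢ (X.image fun x => κ₂ - x) ×ˢ Y).image fun p => p.1 + p.2.1 + p.2.2) ∪
      ((W ×ˢ X ×ˢ (Y.image fun y => κ₃ - y)).image fun p => p.1 + p.2.1 + p.2.2) = univ.erase x₀) :
    W.card ≠ 3 := by
  intro hW
  have hcard : Fintype.card (ZMod m × ZMod l) = m * l := by rw [Fintype.card_prod, ZMod.card, ZMod.card]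
  obtain ⟨w, w', w'', hww', hww'', hw'w'', hWeq⟩ := card_eq_three.1 hW
  have hw : w ∈ W := by rw [hWeq]; simp
  have hw' : w' ∈ W := by rw [hWeq]; simp
  have hw'' : w'' ∈ W := by rw [hWeq]; simp
  have b₁ := card_le_of_shifted_form_part_three_six i₁ i₂ i₃ d₁₂ d₁₃ d₂₃ hcover hW hw hw' hww'
  have b₂ := card_le_of_shifted_form_part_three_six i₁ i₂ i₃ d₁₂ d₁₃ d₂₃ hcover hW hw hw'' hww''
  have b₃ := card_le_of_shifted_form_part_three_six i₁ i₂ i₃ d₁₂ d₁₃ d₂₃ hcover hW hw'' hw' hw'w''.symm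
  rw [hcard] at b₁ b₂ b₃
  rw [show w' - w'' = (w' - w) - (w'' - w) by abel] at b₃
  exact no_three_large_orders h2m hm (w' - w) (w'' - w) b₁ b₂ b₃

end Parity

section ParityLaw

open Literature.Combinatorics.Additive

variable {m l : ℕ} [NeZero m] [NeZero l] {G : Type} [Group G] [DecidableEq G] {ρ τ : ZMod m × ZMod l → G}
  {c₀ : ZMod m × ZMod l} {S T U : Finset G}

/-- The first coset part over `ℤ_m × ℤ_l`, `m ≥ 4`, `2m ∣ l`. [folklore] -/
theorem cube_law_first_coset_part_ne_three_zmod_prod_even (h2m : 2 * m ∣ l) (hm : 4 ≤ m)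
    (hρρ : ∀ a b, ρ a * ρ b = ρ (a + b)) (hρτ : ∀ a b, ρ a * τ b = τ (b - a))
    (hτρ : ∀ a b, τ a * ρ b = τ (a + b)) (hττ : ∀ a b, τ a * τ b = ρ (c₀ + b - a))
    (hρ : Function.Injective ρ) (hτ : Function.Injective τ) (hne : ∀ a b, ρ a ≠ τ b)
    (hsurj : ∀ g, (∃ a, ρ a = g) ∨ (∃ a, τ a = g))
    (h : TripleProductProperty S T U)
    (hS : (univ.filter fun a : ZMod m × ZMod l => ρ a ∈ S).card =
      (univ.filter fun a : ZMod m × ZMod l => τ a ∈ S).card)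
    (hT : (univ.filter fun a : ZMod m × ZMod l => ρ a ∈ T).card =
      (univ.filter fun a : ZMod m × ZMod l => τ a ∈ T).card)
    (hU : (univ.filter fun a : ZMod m × ZMod l => ρ a ∈ U).card =
      (univ.filter fun a : ZMod m × ZMod l => τ a ∈ U).card)
    (hV : 3 * (S.card * T.card * U.card) + 8 = 8 * Fintype.card (ZMod m × ZMod l)) :
    (univ.filter fun a : ZMod m × ZMod l => ρ a ∈ S).card ≠ 3 := by
  obtain ⟨W, X, Y, κ₁, κ₂, κ₃, x₀, cW, -, -, -, i₁, i₂, i₃, d₁₂, d₁₃, d₂₃, hcover⟩ :=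
    cube_shifted_form_of_law hρρ hρτ hτρ hττ hρ hτ hne hsurj h hS hT hU hV
  rw [← cW]
  exact shifted_form_card_ne_three_zmod_prod_even h2m hm i₁ i₂ i₃ d₁₂ d₁₃ d₂₃ hcover

/-- **No coset part of size three in a cube law triple over `Dih(ℤ_m × ℤ_l)`, `m ≥ 4`, `2m ∣ l`** (kernel; any parity, any
presentation constant `c₀`; e.g. `ℤ_4 × ℤ_16`, `ℤ_5 × ℤ_20`, `ℤ_4 × ℤ_88`, `ℤ_5 × ℤ_110`, `ℤ_4 × ℤ_160`, `ℤ_4 × ℤ_232`,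
`ℤ_5 × ℤ_200`). [folklore] -/
theorem cube_law_no_coset_part_three_zmod_prod_even (h2m : 2 * m ∣ l) (hm : 4 ≤ m)
    (hρρ : ∀ a b, ρ a * ρ b = ρ (a + b)) (hρτ : ∀ a b, ρ a * τ b = τ (b - a))
    (hτρ : ∀ a b, τ a * ρ b = τ (a + b)) (hττ : ∀ a b, τ a * τ b = ρ (c₀ + b - a))
    (hρ : Function.Injective ρ) (hτ : Function.Injective τ) (hne : ∀ a b, ρ a ≠ τ b)
    (hsurj : ∀ g, (∃ a, ρ a = g) ∨ (∃ a, τ a = g))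
    (h : TripleProductProperty S T U)
    (hS : (univ.filter fun a : ZMod m × ZMod l => ρ a ∈ S).card =
      (univ.filter fun a : ZMod m × ZMod l => τ a ∈ S).card)
    (hT : (univ.filter fun a : ZMod m × ZMod l => ρ a ∈ T).card =
      (univ.filter fun a : ZMod m × ZMod l => τ a ∈ T).card)
    (hU : (univ.filter fun a : ZMod m × ZMod l => ρ a ∈ U).card =
      (univ.filter fun a : ZMod m × ZMod l => τ a ∈ U).card)
    (hV : 3 * (S.card * T.card * U.card) + 8 = 8 * Fintype.card (ZMod m × ZMod l)) :
    (univ.filter fun a : ZMod m × ZMod l => ρ a ∈ S).card ≠ 3 ∧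
      (univ.filter fun a : ZMod m × ZMod l => ρ a ∈ T).card ≠ 3 ∧
      (univ.filter fun a : ZMod m × ZMod l => ρ a ∈ U).card ≠ 3 := by
  have hV' : 3 * (T.card * U.card * S.card) + 8 = 8 * Fintype.card (ZMod m × ZMod l) := by rw [← hV]; ring
  have hV'' : 3 * (U.card * S.card * T.card) + 8 = 8 * Fintype.card (ZMod m × ZMod l) := by rw [← hV]; ring
  exact ⟨cube_law_first_coset_part_ne_three_zmod_prod_even h2m hm hρρ hρτ hτρ hττ hρ hτ hne hsurj h hS hT hU hV,
    cube_law_first_coset_part_ne_three_zmod_prod_even h2m hm hρρ hρτ hτρ hττ hρ hτ hne hsurj h.rotate hT hU hS hV',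
    cube_law_first_coset_part_ne_three_zmod_prod_even h2m hm hρρ hρτ hτρ hττ hρ hτ hne hsurj h.rotate.rotate hU hS hT
      hV''⟩

end ParityLaw

end Summit.MatrixMultiplication.OmegaCensus
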